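import Summits.QuantumFields.YangMills.Theorems.LuscherReductionTwistedTraceScalingBOStiffCoreCoeff
import Summits.QuantumFields.YangMills.Theorems.LuscherReductionTwistedTraceScalingBOStiffTubeForm
import HarnessLib

/-!
# (B-ST) (L-5′) WEIGHT TRANSPORT across the slow variable: `softWeight χ (oT u x) ∈ (1 ± ε)·softWeight χ (oT 1 x)` on the core, and `N̄ ≤ (1+ε)·‖v₁‖²_w ≤ (1+ε)·‖v‖²_w`
# (lane A of S-BASE, crux `TwistedTraceScaling` stmt-QuantumFields-20203, C4-CORE, the (B-ST) pen; HANDOFF-g21 UPDATE 19:55Z (L-5′))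

`…BOStiffSlowAssembly.form_le_of_product_near` takes a FIBRE-ONLY weight `w̄(x)`; the lead's choice is `w̄(x) = softWeight χ (orthoTube 1 x)`, while the currency of `hST` is the true
weight `w_u(x) = softWeight χ (orthoTube u x) = N/χ`, which depends on the slow variable `u` only through the Faddeev–Popov normalisation `N = gaugeAvg χ` (the Gaussian factor of
`χ = recordChi L s 43 M β` is a function of the fibre coordinate alone: `gaugeCoordSq (orthoTube u x) = ‖P_Γx̂‖²`).  By (P) `…FPWeightCore.fpWeight_core_constant` (`N ∈ N̄(1 ± κ)` on the
fat tube, `κ = C_P(43β^{-s})²`):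
* ★ `softWeight_orthoTube_compare_two` — for `x` in the cap with `orthoTube u x`, `orthoTube u' x` both in the fat tube: `|w_{u'}(x) − w_u(x)| ≤ (2κ/(1−κ))·w_u(x)`;
* ★ `eventually_orthoTube_one_mem_fatTube_of_norm_le` — eventually in `β` (`M ≥ 2`, `0 < s < 1/2`): `‖x̂‖ ≤ r_f ⇒ orthoTube 1 x ∈` fat tube (`…BOSupportGeometry.orthoTube_mem_fatTubeRho`);
* ★★ `eventually_core_weight_transport` — `∃ M₀ ≥ 2, ∀ M ≥ M₀, ∀ ε > 0, ∀ᶠ β, ∀ u, ∀ x ∈ cap` with `‖x̂‖ ≤ r_f` and `recordChi (orthoTube u x) ≠ 0`: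
  `w̄(x) ≤ (1+ε)·w_u(x)` and `w_u(x) ≤ (1+ε)·w̄(x)`;
* ★★★ `eventually_core_sq_norm_transport` — `∃ M₀ ≥ 2, ∀ M ≥ M₀, ∀ ε > 0, ∀ᶠ β, ∀ v` bounded measurable supported in `{recordChi ≠ 0}`, with `v₁ = 𝟙_{(S₂(β)∪S₃(β))ᶜ}·v` (the core piece of
  `…BOStiffTailsRecord` / `…BOStiffAssembly.hST_of_pieces`):  `∫_u ∫_x v₁(orthoTube u x)²·softWeight χ (orthoTube 1 x) dπ dσ³ ≤ (1+ε)·tubeNormSq (softWeight χ) v₁ ≤ (1+ε)·tubeNormSq (softWeight χ) v`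
  (tube disintegration `…BOStiffTubeForm.integral_configMeasure_orthoTube_prod`, `π`-a.e. cap `orthoTransverse_compl_capBalancedSet`, support in the tube set by `recordChi_support`).
HONEST FRAMING: bookkeeping for a stub of a child of the CONDITIONAL route R2b1; (B-ST) OPEN; C4-CORE OPEN; not infinite volume, not a gap, not Clay.
-/

set_option autoImplicit false

noncomputable section

open MeasureTheory Filter Topology Real
open scoped BigOperators
open Literature.MathematicalPhysics.QuantumFieldTheory
open Literature.MathematicalPhysics.QuantumLattice

namespace Summit.QuantumFields.YangMills.Theorems.FemtoTransferGap.TwoLattice.ConstTube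

open Summit.QuantumFields.YangMills.Theorems.FemtoTransferGap
open Summit.QuantumFields.YangMills.Theorems.FemtoTransferGap.TwoLattice
open Summit.QuantumFields.YangMills.Theorems.FemtoTransferGap.TwoLattice.Avg
open Summit.QuantumFields.YangMills.Theorems.FemtoTransferGap.TwoLattice.Stiff
open Summit.QuantumFields.YangMills.Theorems.FemtoTransferGap.TwoLattice.GnChart
open Summit.QuantumFields.YangMills.Theorems.FemtoTransferGap.TwoLattice.Cov
open Summit.QuantumFields.YangMills.Theorems.FemtoTransferGap.TwoLattice.Toron

variable {L : ℕ} [NeZero L]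

/-! ## §1 Two slow points over the same fibre coordinate -/

/-- ★ **WEIGHT COMPARISON BETWEEN TWO SLOW POINTS**: for `x` in the cap with `orthoTube u x` and `orthoTube u' x` both in the fat tube `F` of `χ = recordChi L s K M β`, and (P)
`N̄(1−κ) ≤ gaugeAvg χ ≤ N̄(1+κ)` on `F` (`0 ≤ κ < 1`): `|softWeight χ (orthoTube u' x) − softWeight χ (orthoTube u x)| ≤ (2κ/(1−κ))·softWeight χ (orthoTube u x)`. [cite: Luscher1983, §3] -/
theorem softWeight_orthoTube_compare_two (s K M β : ℝ) {Nbar κ : ℝ} (hκ0 : 0 ≤ κ) (hκ : κ < 1)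
    (hP : ∀ U ∈ fatTubeRho L (fun β => K * powScale s β) (fun b => M * (K * powScale s b)) β,
      Nbar * (1 - κ) ≤ gaugeAvg (recordChi L s K M β) U ∧ gaugeAvg (recordChi L s K M β) U ≤ Nbar * (1 + κ))
    (u u' : GaugeConfig 3 1 SU2) {x : Edge 3 L → Fin 3 → ℝ} (hx : x ∈ capBalancedSet L)
    (hU : orthoTube L u x ∈ fatTubeRho L (fun β => K * powScale s β) (fun b => M * (K * powScale s b)) β)
    (hU' : orthoTube L u' x ∈ fatTubeRho L (fun β => K * powScale s β) (fun b => M * (K * powScale s b)) β) :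
    |softWeight (recordChi L s K M β) (orthoTube L u' x) - softWeight (recordChi L s K M β) (orthoTube L u x)| ≤
      2 * κ / (1 - κ) * softWeight (recordChi L s K M β) (orthoTube L u x) := by
  set c : ℝ := Real.exp (-(‖(gaugeModes L).starProjection (linkEmbed L x)‖ ^ 2 / powScale 1 β ^ 2)) with hcdef
  have hc : 0 < c := Real.exp_pos _
  have hχu : recordChi L s K M β (orthoTube L u x) = c := by
    rw [recordChi_eq_indicator_mul, Set.indicator_of_mem hU, one_mul, gaugeCoordSq_orthoTube u hx]
  have hχu' : recordChi L s K M β (orthoTube L u' x) = c := by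
    rw [recordChi_eq_indicator_mul, Set.indicator_of_mem hU', one_mul, gaugeCoordSq_orthoTube u' hx]
  rw [softWeight_eq_div, softWeight_eq_div, hχu, hχu']
  obtain ⟨hlo, hhiu⟩ := hP _ hU
  obtain ⟨hlo', hhi'⟩ := hP _ hU'
  have h1κ : 0 < 1 - κ := by linarith
  have hdiff : |gaugeAvg (recordChi L s K M β) (orthoTube L u' x) - gaugeAvg (recordChi L s K M β) (orthoTube L u x)| ≤ 2 * κ * Nbar := by
    rw [abs_le]; constructor <;> nlinarith
  have hNu : Nbar ≤ gaugeAvg (recordChi L s K M β) (orthoTube L u x) / (1 - κ) := by rw [le_div_iff₀ h1κ]; exact hlo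
  rw [← sub_div, abs_div, abs_of_pos hc, div_le_iff₀ hc]
  calc |gaugeAvg (recordChi L s K M β) (orthoTube L u' x) - gaugeAvg (recordChi L s K M β) (orthoTube L u x)| ≤ 2 * κ * Nbar := hdiff
    _ ≤ 2 * κ * (gaugeAvg (recordChi L s K M β) (orthoTube L u x) / (1 - κ)) := mul_le_mul_of_nonneg_left hNu (by positivity)
    _ = 2 * κ / (1 - κ) * (gaugeAvg (recordChi L s K M β) (orthoTube L u x) / c) * c := by field_simp

/-- ★ **The reference fibre over the profile ball lies in the fat tube**, eventually in `β` (`M ≥ 2`, `0 < s < 1/2`): `‖x̂‖ ≤ r_f ⇒ orthoTube 1 x ∈ F`. [folklore] -/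
theorem eventually_orthoTube_one_mem_fatTube_of_norm_le {s : ℝ} (hs : 0 < s) (hs2 : s < 1 / 2) {M : ℝ} (hM : 2 ≤ M) :
    ∀ᶠ β : ℝ in atTop, ∀ x : Edge 3 L → Fin 3 → ℝ, ‖linkEmbed L x‖ ≤ min (1 / 40) (powScale (1 / 2) β * btLog β) →
      orthoTube L 1 x ∈ fatTubeRho L (fun β => 43 * powScale s β) (fun b => M * (43 * powScale s b)) β := by
  have ht : Tendsto (fun β : ℝ => powScale (1 / 2 - s) β * btLog β) atTop (𝓝 0) := by
    have h := tendsto_powScale_mul_btLog_pow (p := 1 / 2 - s) (by linarith) 1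
    simpa using h
  have hE0 : (0 : ℝ) < Fintype.card (Edge 3 L) := by exact_mod_cast Fintype.card_pos
  have c0 : (0 : ℝ) < 1 / (4 * Fintype.card (Edge 3 L) + 1) := by positivity
  filter_upwards [ht.eventually (gt_mem_nhds c0)] with β hβ x hx
  have hps : 0 < powScale s β := powScale_pos _ _
  have hsplit : powScale (1 / 2) β = powScale (1 / 2 - s) β * powScale s β := by
    rw [powScale_mul_powScale]; ring_nf
  set t := powScale (1 / 2 - s) β * btLog β with htdef
  have ht0 : 0 ≤ t := mul_nonneg (powScale_pos _ _).le (zero_le_one.trans (one_le_btLog β))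
  have hrf : min (1 / 40) (powScale (1 / 2) β * btLog β) ≤ t * powScale s β := by
    rw [hsplit]; refine (min_le_right _ _).trans (le_of_eq (by rw [htdef]; ring))
  have ht1 : t * (4 * Fintype.card (Edge 3 L) + 1) < 1 := by
    have := (lt_div_iff₀ (by positivity : (0 : ℝ) < 4 * Fintype.card (Edge 3 L) + 1)).mp hβ; linarith
  have hrhalf : min (1 / 40) (powScale (1 / 2) β * btLog β) ≤ 1 / 2 := (min_le_left _ _).trans (by norm_num)
  -- the ball indicator as a profile supported in the `r_f`-ball
  set Ω : LinkSpace L → ℝ := (Metric.closedBall (0 : LinkSpace L) (min (1 / 40) (powScale (1 / 2) β * btLog β))).indicator fun _ => (1 : ℝ) with hΩdef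
  have hΩR : ∀ y : LinkSpace L, Ω y ≠ 0 → ‖y‖ ≤ min (1 / 40) (powScale (1 / 2) β * btLog β) := fun y hy => by
    by_contra h
    exact hy (Set.indicator_of_notMem (by simpa [Metric.mem_closedBall, dist_zero_right] using h) _)
  have hΩx : Ω (linkEmbed L x) ≠ 0 := by
    rw [hΩdef, Set.indicator_of_mem (by simpa [Metric.mem_closedBall, dist_zero_right] using hx)]; exact one_ne_zero
  have hu : orbitDist (1 : GaugeConfig 3 1 SU2) ≤ 0 := by
    rw [show (1 : GaugeConfig 3 1 SU2) = fun _ => (1 : SU2) from rfl, orbitDist_one]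
  refine orthoTube_mem_fatTubeRho (δ' := fun β : ℝ => 43 * powScale s β) (ρ := fun b => M * (43 * powScale s b)) hu hrhalf hΩR ?_ ?_ x hΩx
  · show 4 * min (1 / 40) (powScale (1 / 2) β * btLog β) + 0 < M * (43 * powScale s β)
    have h1 : 4 * t < 86 := by nlinarith
    nlinarith [mul_le_mul_of_nonneg_right hM (by positivity : (0 : ℝ) ≤ 43 * powScale s β)]
  · show (Fintype.card (Edge 3 L) : ℝ) * (4 * min (1 / 40) (powScale (1 / 2) β * btLog β) + 0) < 43 * powScale s β
    have h1 : (Fintype.card (Edge 3 L) : ℝ) * (4 * (t * powScale s β)) < 1 * powScale s β := by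
      have : 4 * (Fintype.card (Edge 3 L) : ℝ) * t < 1 := by nlinarith
      nlinarith
    nlinarith [mul_le_mul_of_nonneg_left hrf (by positivity : (0 : ℝ) ≤ 4 * (Fintype.card (Edge 3 L) : ℝ))]

/-! ## §2 ★★ The record instance, eventually in `β` -/

/-- (P) for the record weight: `∃ M₀ ≥ 2, ∀ M ≥ M₀, ∃ C ≥ 0, ∃ β₀, ∀ β ≥ β₀`, on the fat tube `N̄(1 − Cδ²) ≤ gaugeAvg (recordChi L s 43 M β) ≤ N̄(1 + Cδ²)`, `δ = 43β^{-s}` (`0 < s ≤ 1/3`).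
[cite: Luscher1983, §3] -/
theorem fpWeight_record_sandwich (hLz : Nonempty (NzSite L)) {s : ℝ} (hs : 0 < s) (hs3 : s ≤ 1 / 3) :
    ∃ M₀ : ℝ, 2 ≤ M₀ ∧ ∀ M : ℝ, M₀ ≤ M → ∃ C β₀ : ℝ, 0 ≤ C ∧ ∀ β : ℝ, β₀ ≤ β →
      ∀ U ∈ fatTubeRho L (fun β => 43 * powScale s β) (fun b => M * (43 * powScale s b)) β,
        fpWeightBar L (powScale 1 β) * (1 - C * (43 * powScale s β) ^ 2) ≤ gaugeAvg (recordChi L s 43 M β) U ∧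
          gaugeAvg (recordChi L s 43 M β) U ≤ fpWeightBar L (powScale 1 β) * (1 + C * (43 * powScale s β) ^ 2) := by
  have hδ0 : ∀ β, 0 < 43 * powScale s β := fun β => mul_pos (by norm_num) (powScale_pos s β)
  have hδ : Tendsto (fun β => 43 * powScale s β) atTop (𝓝 0) := by simpa using (tendsto_powScale hs).const_mul 43
  have hsd1 : ∀ᶠ β in atTop, 0 < powScale 1 β ∧ powScale 1 β ≤ (43 * powScale s β) ^ 3 := by
    filter_upwards [eventually_ge_atTop (1 : ℝ)] with β hβ
    have hp := powScale_pos 1 β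
    have h1 : powScale 1 β ≤ powScale s β ^ 3 := powScale_one_le_cube hs3 hβ
    have hps0 : 0 ≤ powScale s β ^ 3 := pow_nonneg (powScale_pos s β).le 3
    refine ⟨hp, h1.trans ?_⟩
    calc powScale s β ^ 3 = 1 * powScale s β ^ 3 := (one_mul _).symm
      _ ≤ 43 ^ 3 * powScale s β ^ 3 := mul_le_mul_of_nonneg_right (by norm_num) hps0
      _ = (43 * powScale s β) ^ 3 := by ring
  obtain ⟨M₀, hM₀, H⟩ := fpWeight_core_constant L hLz hδ0 hδ hsd1
  exact ⟨M₀, hM₀, fun M hM => H M hM⟩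

/-- ★★ **POINTWISE WEIGHT TRANSPORT ON THE CORE OF RECORD**: `∃ M₀ ≥ 2, ∀ M ≥ M₀, ∀ ε > 0, ∀ᶠ β, ∀ u, ∀ x ∈ cap` with `‖x̂‖ ≤ r_f` and `recordChi (orthoTube u x) ≠ 0`:
`softWeight χ (orthoTube 1 x) ≤ (1+ε)·softWeight χ (orthoTube u x)` and `softWeight χ (orthoTube u x) ≤ (1+ε)·softWeight χ (orthoTube 1 x)`. [cite: Luscher1983, §3] -/
theorem eventually_core_weight_transport (hLz : Nonempty (NzSite L)) {s : ℝ} (hs : 0 < s) (hs3 : s ≤ 1 / 3) :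
    ∃ M₀ : ℝ, 2 ≤ M₀ ∧ ∀ M : ℝ, M₀ ≤ M → ∀ ε : ℝ, 0 < ε → ∀ᶠ β : ℝ in atTop, ∀ u : GaugeConfig 3 1 SU2, ∀ x ∈ capBalancedSet L,
      ‖linkEmbed L x‖ ≤ min (1 / 40) (powScale (1 / 2) β * btLog β) → recordChi L s 43 M β (orthoTube L u x) ≠ 0 →
        softWeight (recordChi L s 43 M β) (orthoTube L 1 x) ≤ (1 + ε) * softWeight (recordChi L s 43 M β) (orthoTube L u x) ∧
          softWeight (recordChi L s 43 M β) (orthoTube L u x) ≤ (1 + ε) * softWeight (recordChi L s 43 M β) (orthoTube L 1 x) := by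
  obtain ⟨M₀, hM₀, H⟩ := fpWeight_record_sandwich (L := L) hLz hs hs3
  refine ⟨M₀, hM₀, fun M hM ε hε => ?_⟩
  obtain ⟨C, β₀, hC, hP⟩ := H M hM
  have hM2 : 2 ≤ M := hM₀.trans hM
  have hδ : Tendsto (fun β => 43 * powScale s β) atTop (𝓝 0) := by simpa using (tendsto_powScale hs).const_mul 43
  have hδ2 : Tendsto (fun β => (43 * powScale s β) ^ 2) atTop (𝓝 0) := by simpa using hδ.pow 2
  -- `κ = Cδ² ≤ min(1/2, ε/4)` eventually, so `2κ/(1−κ) ≤ 4κ ≤ ε`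
  filter_upwards [eventually_ge_atTop β₀, eventually_mul_le_of_tendsto hδ2 C (by norm_num : (0 : ℝ) < 1 / 2), eventually_mul_le_of_tendsto hδ2 C (by positivity : (0 : ℝ) < ε / 4),
    eventually_orthoTube_one_mem_fatTube_of_norm_le (L := L) hs (by linarith) hM2] with β hβ0 hκ1 hκε hgeo u x hx hxr hχ
  set κ : ℝ := C * (43 * powScale s β) ^ 2 with hκdef
  have hκ0 : 0 ≤ κ := by positivity
  set F := fatTubeRho L (fun β => 43 * powScale s β) (fun b => M * (43 * powScale s b)) β with hFdef
  have hU : orthoTube L u x ∈ F := by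
    by_contra h; exact hχ (by rw [recordChi_eq_indicator_mul, Set.indicator_of_notMem h, zero_mul])
  have hU₁ : orthoTube L 1 x ∈ F := hgeo x hxr
  have hP' : ∀ U ∈ F, fpWeightBar L (powScale 1 β) * (1 - κ) ≤ gaugeAvg (recordChi L s 43 M β) U ∧ gaugeAvg (recordChi L s 43 M β) U ≤ fpWeightBar L (powScale 1 β) * (1 + κ) :=
    fun U hU => hP β hβ0 U hU
  have hη : 2 * κ / (1 - κ) ≤ ε := by
    rw [div_le_iff₀ (by linarith)]; nlinarith
  have hw0 : ∀ U, 0 ≤ softWeight (recordChi L s 43 M β) U := (softWeight_recordChi_props (L := L) s 43 M β).2.2.1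
  have h1 := softWeight_orthoTube_compare_two s 43 M β hκ0 (by linarith) hP' u 1 hx hU hU₁
  have h2 := softWeight_orthoTube_compare_two s 43 M β hκ0 (by linarith) hP' 1 u hx hU₁ hU
  constructor
  · have h := (abs_le.mp h1).2
    nlinarith [hw0 (orthoTube L u x), mul_le_mul_of_nonneg_right hη (hw0 (orthoTube L u x))]
  · have h := (abs_le.mp h2).2
    nlinarith [hw0 (orthoTube L 1 x), mul_le_mul_of_nonneg_right hη (hw0 (orthoTube L 1 x))]

/-! ## §3 ★★★ The integrated weight transport: `N̄ ≤ (1+ε)·‖v₁‖²_w` -/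

/-- `tubeNormSq w f` in tube coordinates for `f` vanishing off the tube set: `∫ f²w dσ^E = ∫_{(u,x)} f(oT u x)²·w(oT u x) d(σ³⊗π)`. [folklore] -/
theorem tubeNormSq_eq_tube_integral {w f : GaugeConfig 3 L SU2 → ℝ} (hw : Measurable w) {Cw : ℝ} (hCw : ∀ U, |w U| ≤ Cw) (hf : Measurable f) {Cf : ℝ}
    (hCf : ∀ U, |f U| ≤ Cf) (h0 : ∀ U, U ∉ orthoTubeSet L → f U = 0) :
    tubeNormSq w f = ∫ p, f (orthoTube L p.1 p.2) ^ 2 * w (orthoTube L p.1 p.2) ∂(configMeasure SU2 1).prod (orthoTransverse L) := by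
  unfold tubeNormSq
  refine integral_configMeasure_orthoTube_prod ((hf.pow_const 2).mul hw) ⟨Cf ^ 2 * Cw, fun U => ?_⟩ (fun U hU => by rw [h0 U hU]; ring)
  rw [abs_mul, abs_pow]; exact mul_le_mul (pow_le_pow_left₀ (abs_nonneg _) (hCf U) 2) (hCw U) (abs_nonneg _) (sq_nonneg _)

set_option maxHeartbeats 1600000 in
-- long record expressions.
/-- ★★★ **INTEGRATED WEIGHT TRANSPORT FOR THE CORE PIECE OF RECORD**: `∃ M₀ ≥ 2, ∀ M ≥ M₀, ∀ ε > 0, ∀ᶠ β`, for every bounded measurable `v` supported in `{recordChi L s 43 M β ≠ 0}`,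
with `v₁ = 𝟙_{(S₂(β)∪S₃(β))ᶜ}·v`:  `∫_u ∫_x v₁(oT u x)²·softWeight χ (oT 1 x) dπ dσ³ ≤ (1+ε)·tubeNormSq (softWeight χ) v₁` and `tubeNormSq (softWeight χ) v₁ ≤ tubeNormSq (softWeight χ) v`.
[cite: Luscher1983, §3] -/
theorem eventually_core_sq_norm_transport (hLz : Nonempty (NzSite L)) {s : ℝ} (hs : 0 < s) (hs3 : s ≤ 1 / 3) :
    ∃ M₀ : ℝ, 2 ≤ M₀ ∧ ∀ M : ℝ, M₀ ≤ M → ∀ ε : ℝ, 0 < ε → ∀ᶠ β : ℝ in atTop,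
      ∀ v : GaugeConfig 3 L SU2 → ℝ, Measurable v → (∃ C : ℝ, ∀ U, |v U| ≤ C) → (∀ U, v U ≠ 0 → recordChi L s 43 M β U ≠ 0) →
        ∫ u, ∫ x, ({U : GaugeConfig 3 L SU2 | powScale 1 β * btLog β < ‖(gaugeModes L).starProjection (relLinkVec L U)‖} ∪
                {U : GaugeConfig 3 L SU2 | min (1 / 40) (powScale (1 / 2) β * btLog β) / 2 < ‖relLinkVec L U‖})ᶜ.indicator v (orthoTube L u x) ^ 2 *
              softWeight (recordChi L s 43 M β) (orthoTube L 1 x) ∂orthoTransverse L ∂configMeasure SU2 1 ≤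
          (1 + ε) * tubeNormSq (softWeight (recordChi L s 43 M β))
            (({U : GaugeConfig 3 L SU2 | powScale 1 β * btLog β < ‖(gaugeModes L).starProjection (relLinkVec L U)‖} ∪
                {U : GaugeConfig 3 L SU2 | min (1 / 40) (powScale (1 / 2) β * btLog β) / 2 < ‖relLinkVec L U‖})ᶜ.indicator v) ∧
        tubeNormSq (softWeight (recordChi L s 43 M β))
            (({U : GaugeConfig 3 L SU2 | powScale 1 β * btLog β < ‖(gaugeModes L).starProjection (relLinkVec L U)‖} ∪
                {U : GaugeConfig 3 L SU2 | min (1 / 40) (powScale (1 / 2) β * btLog β) / 2 < ‖relLinkVec L U‖})ᶜ.indicator v) ≤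
          tubeNormSq (softWeight (recordChi L s 43 M β)) v := by
  haveI := isFiniteMeasure_orthoTransverse L
  obtain ⟨M₀, hM₀, H⟩ := eventually_core_weight_transport (L := L) hLz hs hs3
  refine ⟨M₀, hM₀, fun M hM ε hε => ?_⟩
  have hM0 : 0 ≤ M := le_trans (by norm_num) (hM₀.trans hM)
  filter_upwards [H M hM ε hε, recordChi_support (L := L) hs hM0] with β hwt hsupp v hv hC hvs
  obtain ⟨Cv, hCv⟩ := hC
  set χ := recordChi L s 43 M β with hχdef
  set rf : ℝ := min (1 / 40) (powScale (1 / 2) β * btLog β) with hrfdef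
  set τ : ℝ := powScale 1 β * btLog β with hτdef
  set S₂ : Set (GaugeConfig 3 L SU2) := {U | τ < ‖(gaugeModes L).starProjection (relLinkVec L U)‖} with hS₂
  set S₃ : Set (GaugeConfig 3 L SU2) := {U | rf / 2 < ‖relLinkVec L U‖} with hS₃
  set f : GaugeConfig 3 L SU2 → ℝ := (S₂ ∪ S₃)ᶜ.indicator v with hfdef
  have hmeas : MeasurableSet (S₂ ∪ S₃)ᶜ := ((measurableSet_far_record (L := L) _).union (measurableSet_shell_record (L := L) _)).compl
  obtain ⟨hfm, hfb⟩ := indicator_piece_props hv hCv hmeas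
  obtain ⟨hwm, hwb, hw0, -⟩ := softWeight_recordChi_props (L := L) s 43 M β
  refine ⟨?_, tubeNormSq_indicator_le s 43 M β hv hCv _⟩
  -- support of `f`: in `{χ ≠ 0}`, hence in the tube set
  have hfs : ∀ U, f U ≠ 0 → χ U ≠ 0 ∧ U ∈ (S₂ ∪ S₃)ᶜ := fun U hU => by
    by_cases hmem : U ∈ (S₂ ∪ S₃)ᶜ
    · rw [hfdef, Set.indicator_of_mem hmem] at hU; exact ⟨hvs U hU, hmem⟩
    · exact absurd (Set.indicator_of_notMem hmem v) hU
  have hf0 : ∀ U, U ∉ orthoTubeSet L → f U = 0 := fun U hU => by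
    by_contra h; exact hU (hsupp U (hfs U h).1).2.2.1
  -- the right side in tube coordinates
  have hR : tubeNormSq (softWeight χ) f = ∫ p, f (orthoTube L p.1 p.2) ^ 2 * softWeight χ (orthoTube L p.1 p.2) ∂(configMeasure SU2 1).prod (orthoTransverse L) :=
    tubeNormSq_eq_tube_integral hwm hwb hfm hfb hf0
  -- the left side as a product integral
  set G : GaugeConfig 3 1 SU2 × (Edge 3 L → Fin 3 → ℝ) → ℝ := fun p => f (orthoTube L p.1 p.2) ^ 2 * softWeight χ (orthoTube L 1 p.2) with hGdef
  have hGm : Measurable G := ((hfm.comp (measurable_orthoTube L)).pow_const 2).mul (hwm.comp ((measurable_orthoTube_right 1).comp measurable_snd))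
  have hGb : ∀ p, |G p| ≤ Cv ^ 2 * Real.exp ((Fintype.card (Edge 3 L) : ℝ) / powScale 1 β ^ 2) := fun p => by
    rw [hGdef]; dsimp only; rw [abs_mul, abs_pow]
    exact mul_le_mul (pow_le_pow_left₀ (abs_nonneg _) (hfb _) 2) (hwb _) (abs_nonneg _) (sq_nonneg _)
  have hGi : Integrable G ((configMeasure SU2 1).prod (orthoTransverse L)) := integrable_of_measurable_abs_le _ hGm hGb
  have hL : ∫ u, ∫ x, f (orthoTube L u x) ^ 2 * softWeight χ (orthoTube L 1 x) ∂orthoTransverse L ∂configMeasure SU2 1 =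
      ∫ p, G p ∂(configMeasure SU2 1).prod (orthoTransverse L) := (integral_prod G hGi).symm
  -- the right-side integrand on the product
  set R : GaugeConfig 3 1 SU2 × (Edge 3 L → Fin 3 → ℝ) → ℝ := fun p => f (orthoTube L p.1 p.2) ^ 2 * softWeight χ (orthoTube L p.1 p.2) with hRdef
  have hRm : Measurable R := ((hfm.comp (measurable_orthoTube L)).pow_const 2).mul (hwm.comp (measurable_orthoTube L))
  have hRb : ∀ p, |R p| ≤ Cv ^ 2 * Real.exp ((Fintype.card (Edge 3 L) : ℝ) / powScale 1 β ^ 2) := fun p => by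
    rw [hRdef]; dsimp only; rw [abs_mul, abs_pow]
    exact mul_le_mul (pow_le_pow_left₀ (abs_nonneg _) (hfb _) 2) (hwb _) (abs_nonneg _) (sq_nonneg _)
  have hRi : Integrable R ((configMeasure SU2 1).prod (orthoTransverse L)) := integrable_of_measurable_abs_le _ hRm hRb
  -- `π`-a.e. the fibre coordinate is in the cap
  have hnull : ((configMeasure SU2 1).prod (orthoTransverse L)) (Set.univ ×ˢ (capBalancedSet L)ᶜ) = 0 := by
    rw [Measure.prod_prod, orthoTransverse_compl_capBalancedSet, mul_zero]
  have hae : ∀ᵐ p ∂(configMeasure SU2 1).prod (orthoTransverse L), p.2 ∈ capBalancedSet L := by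
    rw [ae_iff]
    refine measure_mono_null (fun p hp => ?_) hnull
    exact Set.mk_mem_prod (Set.mem_univ _) hp
  -- pointwise (a.e.): `G ≤ (1+ε)·R`
  have hpt : ∀ᵐ p ∂(configMeasure SU2 1).prod (orthoTransverse L), G p ≤ (1 + ε) * R p := by
    filter_upwards [hae] with p hp
    rw [hGdef, hRdef]; dsimp only
    by_cases hfp : f (orthoTube L p.1 p.2) = 0
    · rw [hfp]; simp
    · obtain ⟨hχp, hmem⟩ := hfs _ hfp
      have hrel : relLinkVec L (orthoTube L p.1 p.2) = linkEmbed L p.2 := relLinkVec_orthoTube L p.1 hp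
      have hxr : ‖linkEmbed L p.2‖ ≤ rf := by
        rw [Set.mem_compl_iff, Set.mem_union, not_or] at hmem
        have h3 : ¬ (rf / 2 < ‖relLinkVec L (orthoTube L p.1 p.2)‖) := hmem.2
        rw [hrel, not_lt] at h3
        have hrf0 : 0 ≤ rf := le_min (by norm_num) (mul_nonneg (powScale_pos _ _).le (zero_le_one.trans (one_le_btLog β)))
        linarith
      have h := (hwt p.1 p.2 hp hxr hχp).1
      rw [mul_comm (1 + ε), mul_assoc]
      exact mul_le_mul_of_nonneg_left (by rw [mul_comm]; exact h) (sq_nonneg _)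
  rw [hL, hR, ← integral_const_mul]
  exact integral_mono_ae hGi (hRi.const_mul _) hpt

end Summit.QuantumFields.YangMills.Theorems.FemtoTransferGap.TwoLattice.ConstTube

end
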